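import Literature.Topology.FourManifolds.SurfaceGroupHomology
import Literature.Topology.FourManifolds.SurfaceGroupGenusOne
import Mathlib.LinearAlgebra.Matrix.Notation
import Mathlib.Data.Matrix.Mul
import Mathlib.Data.ZMod.Basic
import Mathlib.Algebra.BigOperators.Fin
import HarnessLib

/-!
# Pulling back characters of the surface group along a homomorphism: the intersection form
# divides the intersection form of the pull-backs (Heisenberg evaluation of the relator mod `n`)

Topic `Literature/Topology/FourManifolds`; theorems only, over `SurfaceGroupHomology.lean`
(`symplForm` = the intersection form `ν` on `surfaceGen g → ℤ = H₁(Σ_g; ℤ) = H¹(Σ_g; ℤ)`,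
`SurfaceGroup.abelianize` = the Hurewicz map, ZVC 3.6.5) and `GroupTrisections.lean` /
`SurfaceGroupGenusOne.lean` (`SurfaceGroup g = ⟨a₁,b₁,…,a_g,b_g ∣ ∏[aᵢ,bᵢ]⟩`, `presentedLift`,
`SurfaceGroup.mk_surfaceRelator`).  Companion of `SurfaceGroupFreeCharactersIsotropic.lean`, whose
integer Heisenberg group is replaced here by the Heisenberg group over an arbitrary commutative
ring `R` (used with `R = ZMod n`).

* `heis_mul`, `heis_mul_inv`, `heis_inv_mul`, `heis_congr`, `heis_units_inv`, `heis_units_comm` —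
  the Heisenberg group law on the unitriangular matrices `!![1,a,c; 0,1,b; 0,0,1]` over `R` and the
  commutator identity `[(a,b,*), (a',b',*)] = (0, 0, ab' - a'b)`.
* `heis_map_surfaceRelator` — a homomorphism `h : F(a₁,…,b_g) → GL₃(R)` sending every letter `x`
  to a Heisenberg matrix `(α x, β x, *)` sends the relator `∏[aᵢ,bᵢ]` to `(0, 0, ν_R(α, β))`,
  `ν_R(α, β) = ∑ᵢ (α(aᵢ)β(bᵢ) - α(bᵢ)β(aᵢ))`; hence (`heis_symplForm_eq_zero_of_hom`) for a
  homomorphism defined on `S_g` this sum vanishes, and conversely (`exists_heis_hom`) when it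
  vanishes `x ↦ (α x, β x, 0)` extends to `S_g → GL₃(R)`; `heis_hom_apply` — along such a
  homomorphism the two off-diagonal entries are the additive characters extending `α`, `β`.
* `intCast_symplForm` — `ν` commutes with the cast `ℤ → R`.
* `SurfaceGroup.symplForm_dvd_symplForm_pullback` — **the main statement**: for ANY homomorphism
  `ψ : S_g → S_{g'}` and `u, v ∈ ℤ^{2g'} = H¹(Σ_{g'})` (a vector `u` is the character
  `s ↦ ⟨ab s, u⟩`), the pulled-back characters `ψ^*u = (⟨ab ψ(x), u⟩)_x`, `ψ^*v ∈ ℤ^{2g}` satisfy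
  `ν(u, v) ∣ ν(ψ^*u, ψ^*v)`.  (Topologically `ν` on `H¹` is the cup product and
  `ψ^*u ∪ ψ^*v = deg(ψ) · (u ∪ v)`, ZVC 3.7.6 / 3.7.12; we only need and prove divisibility.)
  Proof: with `n = ν(u,v)` the letters `y ↦ (u y, v y, 0) ∈ Heis(ℤ/n)` define a homomorphism
  `ρ` on `S_{g'}` (the relator goes to `(0,0,n) = 1`); evaluating the relator of `S_g` through the
  homomorphism `ρ ∘ ψ` gives `(0, 0, ν(ψ^*u, ψ^*v)) = 1` in `Heis(ℤ/n)`.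

Not here: the consequence for automorphisms (`im(Aut S_g → GL_{2g}(ℤ)) ⊆ Sp^{±}`), which is in
`SurfaceGroupAutSymplectic.lean`; the equality `ν(ψ^*u, ψ^*v) = deg(ψ) ν(u, v)`.

## References

* H. Zieschang, E. Vogt, H.-D. Coldewey, *Surfaces and Planar Discontinuous Groups*, LNM 835,
  Springer (1980), 3.6.3–3.6.5 (intersection form), 3.7.6–3.7.12 (degree and intersection
  numbers). [ZieschangVogtColdewey1980]
* A. Hatcher, *Algebraic Topology*, CUP (2002), §3.2 Example 3.7 (cup product of `Σ_g`).
  [HatcherAT2002]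
-/

noncomputable section

namespace Literature.Topology.FourManifolds

open Multiplicative

section Heisenberg

variable {R : Type*} [CommRing R]

/-- The Heisenberg group law over a commutative ring:
`(a,b,c)·(a',b',c') = (a+a', b+b', c+c'+ab')` on unitriangular `3 × 3` matrices. [folklore] -/
theorem heis_mul (a b c a' b' c' : R) :
    (!![1, a, c; 0, 1, b; 0, 0, 1] : Matrix (Fin 3) (Fin 3) R) * !![1, a', c'; 0, 1, b'; 0, 0, 1] =
      !![1, a + a', c + c' + a * b'; 0, 1, b + b'; 0, 0, 1] := by
  rw [Matrix.mul_fin_three]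
  congr 1
  funext i j
  fin_cases i <;> fin_cases j <;> simp <;> ring

/-- Equal parameters give equal Heisenberg matrices (used to close goals by `ring`). [folklore] -/
theorem heis_congr {a b c a' b' c' : R} (ha : a = a') (hb : b = b') (hc : c = c') :
    (!![1, a, c; 0, 1, b; 0, 0, 1] : Matrix (Fin 3) (Fin 3) R) =
      !![1, a', c'; 0, 1, b'; 0, 0, 1] := by
  subst ha hb hc
  rfl

/-- Right inverse of a Heisenberg matrix. [folklore] -/
theorem heis_mul_inv (a b c : R) :
    (!![1, a, c; 0, 1, b; 0, 0, 1] : Matrix (Fin 3) (Fin 3) R) *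
        !![1, -a, a * b - c; 0, 1, -b; 0, 0, 1] = 1 := by
  rw [heis_mul, Matrix.one_fin_three]
  exact heis_congr (by ring) (by ring) (by ring)

/-- Left inverse of a Heisenberg matrix. [folklore] -/
theorem heis_inv_mul (a b c : R) :
    (!![1, -a, a * b - c; 0, 1, -b; 0, 0, 1] : Matrix (Fin 3) (Fin 3) R) *
        !![1, a, c; 0, 1, b; 0, 0, 1] = 1 := by
  rw [heis_mul, Matrix.one_fin_three]
  exact heis_congr (by ring) (by ring) (by ring)

/-- The inverse, in `GL₃(R)`, of a unit whose matrix is a Heisenberg matrix. [folklore] -/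
theorem heis_units_inv {A : (Matrix (Fin 3) (Fin 3) R)ˣ} {a b c : R}
    (hA : (A : Matrix (Fin 3) (Fin 3) R) = !![1, a, c; 0, 1, b; 0, 0, 1]) :
    ((A⁻¹ : (Matrix (Fin 3) (Fin 3) R)ˣ) : Matrix (Fin 3) (Fin 3) R) =
      !![1, -a, a * b - c; 0, 1, -b; 0, 0, 1] :=
  calc ((A⁻¹ : (Matrix (Fin 3) (Fin 3) R)ˣ) : Matrix (Fin 3) (Fin 3) R)
        = (A⁻¹ : (Matrix (Fin 3) (Fin 3) R)ˣ) *
            ((A : Matrix (Fin 3) (Fin 3) R) * !![1, -a, a * b - c; 0, 1, -b; 0, 0, 1]) := by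
          rw [hA, heis_mul_inv, mul_one]
    _ = !![1, -a, a * b - c; 0, 1, -b; 0, 0, 1] := by rw [← mul_assoc, Units.inv_mul, one_mul]

/-- The commutator identity of the Heisenberg group: `[(a,b,*), (a',b',*)] = (0, 0, ab' - a'b)`.
[folklore] -/
theorem heis_units_comm {A B : (Matrix (Fin 3) (Fin 3) R)ˣ} {a b c a' b' c' : R}
    (hA : (A : Matrix (Fin 3) (Fin 3) R) = !![1, a, c; 0, 1, b; 0, 0, 1])
    (hB : (B : Matrix (Fin 3) (Fin 3) R) = !![1, a', c'; 0, 1, b'; 0, 0, 1]) :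
    ((A * B * A⁻¹ * B⁻¹ : (Matrix (Fin 3) (Fin 3) R)ˣ) : Matrix (Fin 3) (Fin 3) R) =
      !![1, 0, a * b' - a' * b; 0, 1, 0; 0, 0, 1] := by
  rw [Units.val_mul, Units.val_mul, Units.val_mul, heis_units_inv hA, heis_units_inv hB, hA, hB,
    heis_mul, heis_mul, heis_mul]
  exact heis_congr (by ring) (by ring) (by ring)

/-- **Evaluation of the surface relator in a Heisenberg group.**  If a homomorphism
`h : F(a₁,b₁,…,a_g,b_g) → GL₃(R)` sends every letter `x` to a Heisenberg matrix `(α x, β x, *)`,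
then it sends `∏ᵢ[aᵢ,bᵢ]` to the central element `(0, 0, ∑ᵢ (α(aᵢ)β(bᵢ) - α(bᵢ)β(aᵢ)))`.
[folklore] -/
theorem heis_map_surfaceRelator {g : ℕ}
    (h : FreeGroup (surfaceGen g) →* (Matrix (Fin 3) (Fin 3) R)ˣ) (α β : surfaceGen g → R)
    (hgen : ∀ x, ∃ c,
      (h (FreeGroup.of x) : Matrix (Fin 3) (Fin 3) R) = !![1, α x, c; 0, 1, β x; 0, 0, 1]) :
    (h (surfaceRelator g) : Matrix (Fin 3) (Fin 3) R) =
      !![1, 0, ∑ i : Fin g, (α (i, false) * β (i, true) - α (i, true) * β (i, false));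
        0, 1, 0; 0, 0, 1] := by
  have hcomm : ∀ i : Fin g,
      (h (genA i * genB i * (genA i)⁻¹ * (genB i)⁻¹) : Matrix (Fin 3) (Fin 3) R) =
        !![1, 0, α (i, false) * β (i, true) - α (i, true) * β (i, false); 0, 1, 0; 0, 0, 1] := by
    intro i
    obtain ⟨c, hc⟩ := hgen (i, false)
    obtain ⟨c', hc'⟩ := hgen (i, true)
    rw [map_mul, map_mul, map_mul, map_inv, map_inv, genA, genB]
    exact heis_units_comm hc hc'
  have hprod : ∀ l : List (Fin g),
      (((l.map fun i => genA i * genB i * (genA i)⁻¹ * (genB i)⁻¹).map h).prod :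
          Matrix (Fin 3) (Fin 3) R) =
        !![1, 0, (l.map fun i => α (i, false) * β (i, true) - α (i, true) * β (i, false)).sum;
          0, 1, 0; 0, 0, 1] := by
    intro l
    induction l with
    | nil => rw [List.map_nil, List.map_nil, List.map_nil, List.prod_nil, List.sum_nil,
        Units.val_one, Matrix.one_fin_three]
    | cons i l ih =>
      rw [List.map_cons, List.map_cons, List.map_cons, List.prod_cons, List.sum_cons, Units.val_mul,
        ih, hcomm, heis_mul]
      exact heis_congr (by ring) (by ring) (by ring)
  unfold surfaceRelator
  rw [map_list_prod, hprod, ← Fin.sum_univ_def]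

/-- **The relator kills `ν`**: if a homomorphism `ρ : S_g → GL₃(R)` sends every generator `x` to
a Heisenberg matrix `(α x, β x, *)`, then `∑ᵢ (α(aᵢ)β(bᵢ) - α(bᵢ)β(aᵢ)) = 0` in `R`. [folklore] -/
theorem heis_symplForm_eq_zero_of_hom {g : ℕ} (ρ : SurfaceGroup g →* (Matrix (Fin 3) (Fin 3) R)ˣ)
    (α β : surfaceGen g → R)
    (hgen : ∀ x, ∃ c, (ρ (PresentedGroup.of x) : Matrix (Fin 3) (Fin 3) R) =
      !![1, α x, c; 0, 1, β x; 0, 0, 1]) :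
    ∑ i : Fin g, (α (i, false) * β (i, true) - α (i, true) * β (i, false)) = 0 := by
  have key := heis_map_surfaceRelator (ρ.comp (PresentedGroup.mk _)) α β fun x => hgen x
  rw [MonoidHom.comp_apply, SurfaceGroup.mk_surfaceRelator, map_one, Units.val_one] at key
  have h02 := congrArg (fun M : Matrix (Fin 3) (Fin 3) R => M 0 2) key
  simp only [Matrix.one_apply_ne (by decide : (0 : Fin 3) ≠ 2)] at h02
  have h02' : (!![1, 0, ∑ i : Fin g, (α (i, false) * β (i, true) - α (i, true) * β (i, false));
      0, 1, 0; 0, 0, 1] : Matrix (Fin 3) (Fin 3) R) 0 2 =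
      ∑ i : Fin g, (α (i, false) * β (i, true) - α (i, true) * β (i, false)) := rfl
  rw [h02'] at h02
  exact h02.symm

/-- **Heisenberg representations of `S_g`**: if `∑ᵢ (α(aᵢ)β(bᵢ) - α(bᵢ)β(aᵢ)) = 0` in `R`, the
assignment `x ↦ (α x, β x, 0)` extends to a homomorphism `S_g → GL₃(R)`. [folklore] -/
theorem exists_heis_hom {g : ℕ} (α β : surfaceGen g → R)
    (hαβ : ∑ i : Fin g, (α (i, false) * β (i, true) - α (i, true) * β (i, false)) = 0) :
    ∃ ρ : SurfaceGroup g →* (Matrix (Fin 3) (Fin 3) R)ˣ,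
      ∀ x, (ρ (PresentedGroup.of x) : Matrix (Fin 3) (Fin 3) R) =
        !![1, α x, 0; 0, 1, β x; 0, 0, 1] := by
  let u : surfaceGen g → (Matrix (Fin 3) (Fin 3) R)ˣ := fun x =>
    ⟨!![1, α x, 0; 0, 1, β x; 0, 0, 1], !![1, -α x, α x * β x - 0; 0, 1, -β x; 0, 0, 1],
      heis_mul_inv _ _ _, heis_inv_mul _ _ _⟩
  have hu : ∀ x, (u x : Matrix (Fin 3) (Fin 3) R) = !![1, α x, 0; 0, 1, β x; 0, 0, 1] :=
    fun x => rfl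
  have hrel : FreeGroup.lift u (surfaceRelator g) = 1 := by
    apply Units.ext
    rw [heis_map_surfaceRelator (FreeGroup.lift u) α β fun x =>
      ⟨0, by rw [FreeGroup.lift_apply_of, hu]⟩, hαβ, Units.val_one, Matrix.one_fin_three]
  refine ⟨presentedLift (FreeGroup.lift u) (fun r hr => ?_), fun x => ?_⟩
  · rw [Set.mem_singleton_iff] at hr
    rw [hr, hrel]
  · rw [presentedLift_of, FreeGroup.lift_apply_of, hu]

/-- Along a homomorphism `ρ : S_g → GL₃(R)` whose generators go to Heisenberg matrices with
off-diagonal entries `χ(x), χ'(x)` for two characters `χ, χ' : S_g → R`, EVERY element `s` goes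
to a Heisenberg matrix with off-diagonal entries `χ(s), χ'(s)`. [folklore] -/
theorem heis_hom_apply {g : ℕ} (ρ : SurfaceGroup g →* (Matrix (Fin 3) (Fin 3) R)ˣ)
    (χ χ' : SurfaceGroup g →* Multiplicative R)
    (hgen : ∀ x, ∃ c, (ρ (PresentedGroup.of x) : Matrix (Fin 3) (Fin 3) R) =
      !![1, toAdd (χ (PresentedGroup.of x)), c; 0, 1, toAdd (χ' (PresentedGroup.of x)); 0, 0, 1])
    (s : SurfaceGroup g) :
    ∃ c, (ρ s : Matrix (Fin 3) (Fin 3) R) = !![1, toAdd (χ s), c; 0, 1, toAdd (χ' s); 0, 0, 1] := by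
  obtain ⟨w, rfl⟩ := PresentedGroup.mk_surjective _ s
  induction w using FreeGroup.induction_on with
  | C1 =>
    refine ⟨0, ?_⟩
    rw [map_one (PresentedGroup.mk _), map_one ρ, map_one χ, map_one χ', Units.val_one, toAdd_one,
      Matrix.one_fin_three]
  | of x => exact hgen x
  | inv_of x _ =>
    obtain ⟨c, hc⟩ := hgen x
    refine ⟨toAdd (χ (PresentedGroup.of x)) * toAdd (χ' (PresentedGroup.of x)) - c, ?_⟩
    rw [map_inv (PresentedGroup.mk _), map_inv ρ, map_inv χ, map_inv χ', toAdd_inv, toAdd_inv]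
    exact heis_units_inv hc
  | mul x y ihx ihy =>
    obtain ⟨c, hc⟩ := ihx
    obtain ⟨c', hc'⟩ := ihy
    refine ⟨c + c' + toAdd (χ (PresentedGroup.mk _ x)) * toAdd (χ' (PresentedGroup.mk _ y)), ?_⟩
    rw [map_mul (PresentedGroup.mk _), map_mul ρ, map_mul χ, map_mul χ', Units.val_mul, hc, hc',
      heis_mul, toAdd_mul, toAdd_mul]

end Heisenberg

/-- The intersection form commutes with the cast `ℤ → R`. [folklore] -/
theorem intCast_symplForm {R : Type*} [CommRing R] {ι : Type*} [Fintype ι] (u v : ι × Bool → ℤ) :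
    ((symplForm u v : ℤ) : R) =
      ∑ i, ((u (i, false) : R) * (v (i, true) : R) - (u (i, true) : R) * (v (i, false) : R)) := by
  rw [symplForm_apply]
  push_cast
  rfl

/-- **The intersection form divides the intersection form of pulled-back characters.**  Let
`ψ : S_g → S_{g'}` be any homomorphism of surface groups and `u, v ∈ ℤ^{2g'}`, read as additive
characters `s ↦ ⟨ab(s), u⟩` of `S_{g'}` (`ab` = `SurfaceGroup.abelianize`, `⟨,⟩` = dot product).
The pulled-back characters `u ∘ ψ`, `v ∘ ψ` of `S_g` have coordinate vectors
`ψ^*u = (⟨ab(ψ aᵢ), u⟩, ⟨ab(ψ bᵢ), u⟩)ᵢ`, `ψ^*v ∈ ℤ^{2g}`, and `ν(u, v) ∣ ν(ψ^*u, ψ^*v)`.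
(Topologically: `ν` on `H¹` is the cup product, and `ψ^*u ∪ ψ^*v = deg(ψ)(u ∪ v)`,
ZVC 3.7.6–3.7.12.)  Proof: `n := ν(u,v)`; `y ↦ (u y, v y, 0) ∈ Heis(ℤ/n)` extends to a
homomorphism `ρ` of `S_{g'}` (`exists_heis_hom`: the relator goes to `(0,0,n) = 1`), along
which the off-diagonal entries are the characters `u, v` (`heis_hom_apply`); the relator of `S_g`
dies under `ρ ∘ ψ`, i.e. `(0,0,ν(ψ^*u, ψ^*v)) = 1` in `Heis(ℤ/n)` (`heis_symplForm_eq_zero_of_hom`).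
[folklore] -/
theorem SurfaceGroup.symplForm_dvd_symplForm_pullback {g g' : ℕ}
    (ψ : SurfaceGroup g →* SurfaceGroup g') (u v : surfaceGen g' → ℤ) :
    symplForm u v ∣
      symplForm (fun x => toAdd (SurfaceGroup.abelianize g' (ψ (PresentedGroup.of x))) ⬝ᵥ u)
        (fun x => toAdd (SurfaceGroup.abelianize g' (ψ (PresentedGroup.of x))) ⬝ᵥ v) := by
  set n : ℤ := symplForm u v with hn
  -- the characters `s ↦ ⟨ab s, w⟩ mod n`
  let θ : (surfaceGen g' → ℤ) → SurfaceGroup g' →* Multiplicative (ZMod n.natAbs) := fun w =>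
    MonoidHom.mk'
      (fun s => ofAdd (((toAdd (SurfaceGroup.abelianize g' s) ⬝ᵥ w : ℤ) : ZMod n.natAbs)))
      (fun s t => by
        rw [map_mul, toAdd_mul, add_dotProduct, Int.cast_add, ofAdd_add])
  have hθ : ∀ w s, toAdd (θ w s) =
      ((toAdd (SurfaceGroup.abelianize g' s) ⬝ᵥ w : ℤ) : ZMod n.natAbs) := fun w s => rfl
  have hθof : ∀ w x, toAdd (θ w (PresentedGroup.of x)) = ((w x : ℤ) : ZMod n.natAbs) := by
    intro w x
    rw [hθ, SurfaceGroup.abelianize_of, toAdd_ofAdd, single_dotProduct, one_mul]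
  -- the Heisenberg representation `y ↦ (u y, v y, 0)` of `S_{g'}` over `ℤ/n`
  have huv : ∑ i : Fin g',
      (((u (i, false) : ℤ) : ZMod n.natAbs) * ((v (i, true) : ℤ) : ZMod n.natAbs) -
        ((u (i, true) : ℤ) : ZMod n.natAbs) * ((v (i, false) : ℤ) : ZMod n.natAbs)) = 0 := by
    rw [← intCast_symplForm, ← hn]
    exact (ZMod.intCast_zmod_eq_zero_iff_dvd n n.natAbs).2 (Int.natAbs_dvd.2 dvd_rfl)
  obtain ⟨ρ, hρ⟩ := exists_heis_hom (fun y => ((u y : ℤ) : ZMod n.natAbs))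
    (fun y => ((v y : ℤ) : ZMod n.natAbs)) huv
  have hent := heis_hom_apply ρ (θ u) (θ v) (fun y => ⟨0, by rw [hρ, hθof, hθof]⟩)
  -- evaluate the relator of `S_g` through `ρ ∘ ψ`
  have key := heis_symplForm_eq_zero_of_hom (ρ.comp ψ)
    (fun x =>
      ((toAdd (SurfaceGroup.abelianize g' (ψ (PresentedGroup.of x))) ⬝ᵥ u : ℤ) : ZMod n.natAbs))
    (fun x =>
      ((toAdd (SurfaceGroup.abelianize g' (ψ (PresentedGroup.of x))) ⬝ᵥ v : ℤ) : ZMod n.natAbs))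
    (fun x => by
      obtain ⟨c, hc⟩ := hent (ψ (PresentedGroup.of x))
      exact ⟨c, by rw [MonoidHom.comp_apply, hc, hθ, hθ]⟩)
  have hcast : ((symplForm
      (fun x => toAdd (SurfaceGroup.abelianize g' (ψ (PresentedGroup.of x))) ⬝ᵥ u)
      (fun x => toAdd (SurfaceGroup.abelianize g' (ψ (PresentedGroup.of x))) ⬝ᵥ v) : ℤ) :
        ZMod n.natAbs) = 0 := by
    rw [intCast_symplForm]
    exact key
  exact Int.natAbs_dvd.1 ((ZMod.intCast_zmod_eq_zero_iff_dvd _ _).1 hcast)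

end Literature.Topology.FourManifolds

end
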